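import Literature.MathematicalPhysics.KineticTheory.Hilbert6Wave0Proofs
import Literature.MathematicalPhysics.KineticTheory.Hilbert6Wave0WeakFormProofs
import HarnessLib

/-!
# Hilbert's sixth problem (family `hilbert6`), wave 0: the equality case of Boltzmann's `H`-theorem (proofs)

Topic: MathematicalPhysics / KineticTheory. Discharge of the named fact
`Literature.MathematicalPhysics.KineticTheory.integral_collisionOp_mul_log_eq_zero_iff`
(**hilbert6.S12**, equality case of the `H`-theorem for the hard-sphere collision operator) stated
in `Literature/MathematicalPhysics/KineticTheory/Hilbert6Wave0.lean`:

* `integral_collisionOp_mul_log_eq_zero_iff_holds`: in velocity dimension `d ≥ 2`, for a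
  continuous positive `f` whose weak entropy integrand `((v - v_*)·ω)_+ (f'f_*' - f f_*) log f(v)`
  is integrable on `E × E × S^{d-1}`, `∫ Q(f,f)(v) log f(v) dv = 0` if and only if `f` is a
  (wide-sense) Maxwellian `exp (a + ⟪b, v⟫ + c ‖v‖²)`.

The proof is the one printed in Cercignani–Illner–Pulvirenti (1994), §3.2, pp. 42–43 (the
result going back to Boltzmann 1872):

1. (`Hilbert6Wave0WeakFormProofs`, `CollisionWeakForm`; CIP (3.2.4)) by the weak formulation with
   `φ = log f`, `∫ Q(f,f) log f dv = -D(f)` where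
   `D(f) = ¼ ∫∫∫ ((v - v_*)·ω)_+ (f'f_*' - f f_*) log (f'f_*'/(f f_*)) dω dv_* dv` is the entropy
   production (`Literature.Analysis.FluidPDE.entropyProduction`), whose integrand is pointwise
   `≥ 0` by the elementary inequality `(z - y) log (y/z) ≤ 0` (CIP (3.2.5)).
2. (`isCollisionInvariant_log_of_hardSphereEntropyIntegrand_eq_zero`; CIP (3.2.5)–(3.2.6)) If
   `∫ Q(f,f) log f = 0`, the integrable nonnegative entropy-production integrand has integral `0`,
   so it vanishes a.e. on `E × E × S^{d-1}`; being continuous, and the measure `dv dv_* dω`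
   charging every nonempty open set (Mathlib's `IsOpenPosMeasure` for Lebesgue measure and for
   `Measure.toSphere`), it vanishes everywhere. Since `(z - y) log (z/y) = 0` forces `y = z` for
   `y, z > 0`, detailed balance `f'f_*' = f f_*` holds wherever `(v - v_*)·ω > 0`, hence for all
   `(v, v_*, ω)` (reverse `ω` when `(v - v_*)·ω < 0`; the collision is trivial when
   `(v - v_*)·ω = 0`): `log f` is a continuous collision invariant.
3. (CIP (3.2.3), Thm 3.1.1) By the classification of continuous collision invariants in dimension
   `≥ 2` (`IsCollisionInvariant.exists_eq_quadratic_holds` of `Hilbert6Wave0Proofs`),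
   `log f(v) = a + ⟪b, v⟫ + c ‖v‖²`, i.e. `f` is a Maxwellian.
4. Conversely `Q(M, M) = 0` pointwise for a Maxwellian `M` (`collisionOp_eq_zero_of_isMaxwellian`),
   so the entropy production integral vanishes.

No new definitions are introduced (this file is a pure proof file).

## References

* L. Boltzmann, *Weitere Studien über das Wärmegleichgewicht unter Gasmolekülen*, Sitzungsber.
  Kais. Akad. Wiss. Wien, Math.-Naturwiss. Cl. 66 (1872), 275–370.
* C. Cercignani, R. Illner, M. Pulvirenti, *The Mathematical Theory of Dilute Gases*, Applied
  Mathematical Sciences 106, Springer (1994): §3.1 Thm 3.1.1 (pp. 37–40), §3.2 (3.2.1)–(3.2.7)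
  (pp. 42–43).
* C. Villani, *A review of mathematical topics in collisional kinetic theory*, Handbook of
  Mathematical Fluid Dynamics I (2002), Ch. 1 §2.4.
-/

open MeasureTheory Metric Real Set Filter Topology
open scoped InnerProductSpace ENNReal

noncomputable section

namespace Literature.MathematicalPhysics.KineticTheory

open Literature.Analysis.FluidPDE

variable {E : Type*} [NormedAddCommGroup E] [InnerProductSpace ℝ E]

/-! ### The elementary equality case `(z - y) log (z / y) = 0 ↔ z = y` -/

omit [InnerProductSpace ℝ E] in
/-- The equality case of the elementary inequality `(z - y) log (y/z) ≤ 0` behind the `H`-theorem: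
for `y, z > 0`, `(z - y) log (z/y) = 0` iff `z = y` (CIP 1994 §3.2 (3.2.5): "Eq. (2.5) becomes an
equality if and only if `y = z`"). [cite: CIPDiluteGases1994, §3.2 (3.2.5), p. 43] -/
theorem sub_mul_log_div_eq_zero_iff {y z : ℝ} (hy : 0 < y) (hz : 0 < z) :
    (z - y) * log (z / y) = 0 ↔ z = y := by
  refine ⟨fun h => ?_, fun h => by rw [h, sub_self, zero_mul]⟩
  rcases mul_eq_zero.1 h with h | h
  · linarith
  · have h1 : z / y = 1 := eq_one_of_pos_of_log_eq_zero (div_pos hz hy) h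
    rwa [div_eq_one_iff_eq hy.ne'] at h1

/-! ### Detailed balance from vanishing entropy production integrand -/

/-- The entropy-production integrand of the hard-sphere kernel at `((v, v_*), ω)`:
`((v - v_*)·ω)_+ (f'f_*' - f f_*) log (f'f_*' / (f f_*))` vanishes at `((v, v_*), ω)` **and** at
`((v, v_*), -ω)` only if detailed balance `f(v') f(v_*') = f(v) f(v_*)` holds (for `f > 0`):
if `(v - v_*)·ω > 0` the kernel is positive and `sub_mul_log_div_eq_zero_iff` applies; if
`(v - v_*)·ω < 0` the same holds at `-ω`, which defines the same collision; if `(v - v_*)·ω = 0`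
the collision is the identity (CIP 1994 §3.2, passage from (3.2.5) to (3.2.6), p. 43).
[cite: CIPDiluteGases1994, §3.2 (3.2.5)–(3.2.6), p. 43] -/
theorem mul_collide_eq_mul_of_hardSphereEntropyIntegrand_eq_zero {f : E → ℝ}
    (hpos : ∀ v, 0 < f v) (p : E × E) (ω : sphere (0 : E) 1)
    (h : ∀ ω' : sphere (0 : E) 1, (ω' = ω ∨ ω' = -ω) →
      hardSphereKernel p ω' * ((f (collide ω' p).1 * f (collide ω' p).2 - f p.1 * f p.2) *
        log (f (collide ω' p).1 * f (collide ω' p).2 / (f p.1 * f p.2))) = 0) :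
    f (collide ω p).1 * f (collide ω p).2 = f p.1 * f p.2 := by
  have hb : 0 < f p.1 * f p.2 := mul_pos (hpos _) (hpos _)
  rcases lt_trichotomy 0 ⟪p.1 - p.2, (ω : E)⟫_ℝ with hlt | heq | hgt
  · -- `(v - v_*)·ω > 0`: the kernel is positive at `ω`
    have hk : hardSphereKernel p ω ≠ 0 := by
      rw [hardSphereKernel, max_eq_left hlt.le]; exact hlt.ne'
    have h1 := h ω (Or.inl rfl)
    rcases mul_eq_zero.1 h1 with h1 | h1
    · exact absurd h1 hk
    · exact (sub_mul_log_div_eq_zero_iff hb (mul_pos (hpos _) (hpos _))).1 h1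
  · -- `(v - v_*)·ω = 0`: the collision is the identity
    simp only [collide, ← heq, zero_smul, sub_zero, add_zero]
  · -- `(v - v_*)·ω < 0`: the kernel is positive at `-ω`, which defines the same collision
    have hgt' : 0 < ⟪p.1 - p.2, ((-ω : sphere (0 : E) 1) : E)⟫_ℝ := by
      rw [coe_neg_sphere, inner_neg_right]; linarith
    have hk : hardSphereKernel p (-ω) ≠ 0 := by
      rw [hardSphereKernel, max_eq_left hgt'.le]; exact hgt'.ne'
    have h1 := h (-ω) (Or.inr rfl)
    rw [collide_neg_dir] at h1
    rcases mul_eq_zero.1 h1 with h1 | h1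
    · exact absurd h1 hk
    · exact (sub_mul_log_div_eq_zero_iff hb (mul_pos (hpos _) (hpos _))).1 h1

/-- **Detailed balance** (CIP 1994 §3.2 (3.2.6) and the sentence following it, p. 43): if `f > 0`
and the entropy-production integrand `((v - v_*)·ω)_+ (f'f_*' - f f_*) log (f'f_*' / (f f_*))`
vanishes identically on `E × E × S^{d-1}`, then `f'f_*' = f f_*` for every collision, i.e.
`log f` is a collision invariant ("taking the logarithms of both sides of Eq. (2.6), we find that
`φ = log f` satisfies Eq. (1.13)"). [cite: CIPDiluteGases1994, §3.2 (3.2.6), p. 43] -/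
theorem isCollisionInvariant_log_of_hardSphereEntropyIntegrand_eq_zero {f : E → ℝ}
    (hpos : ∀ v, 0 < f v)
    (h : ∀ (p : E × E) (ω : sphere (0 : E) 1),
      hardSphereKernel p ω * ((f (collide ω p).1 * f (collide ω p).2 - f p.1 * f p.2) *
        log (f (collide ω p).1 * f (collide ω p).2 / (f p.1 * f p.2))) = 0) :
    IsCollisionInvariant (fun v => log (f v)) := by
  intro ω p
  have hdb := mul_collide_eq_mul_of_hardSphereEntropyIntegrand_eq_zero hpos p ω
    (fun ω' _ => h p ω')
  have e := congrArg log hdb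
  rwa [log_mul (hpos _).ne' (hpos _).ne', log_mul (hpos _).ne' (hpos _).ne'] at e

/-- The entropy-production integrand of the hard-sphere kernel,
`((v, v_*), ω) ↦ ((v - v_*)·ω)_+ (f'f_*' - f f_*) log (f'f_*' / (f f_*))` (the integrand of
`Literature.Analysis.FluidPDE.entropyProduction hardSphereKernel f`, written out), is continuous on
`E × E × S^{d-1}` for a continuous positive `f`. [folklore] -/
theorem continuous_hardSphereEntropyIntegrand {f : E → ℝ} (hpos : ∀ v, 0 < f v)
    (hcont : Continuous f) :
    Continuous (fun q : (E × E) × sphere (0 : E) 1 => hardSphereKernel q.1 q.2 *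
      ((f (collide q.2 q.1).1 * f (collide q.2 q.1).2 - f q.1.1 * f q.1.2) *
        log (f (collide q.2 q.1).1 * f (collide q.2 q.1).2 / (f q.1.1 * f q.1.2)))) := by
  have hB : Continuous (fun q : (E × E) × sphere (0 : E) 1 => hardSphereKernel q.1 q.2) := by
    unfold hardSphereKernel; fun_prop
  have h1 : Continuous (fun q : (E × E) × sphere (0 : E) 1 => f (collide q.2 q.1).1) :=
    hcont.comp continuous_collide_uncurry.fst
  have h2 : Continuous (fun q : (E × E) × sphere (0 : E) 1 => f (collide q.2 q.1).2) :=
    hcont.comp continuous_collide_uncurry.snd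
  have h3 : Continuous (fun q : (E × E) × sphere (0 : E) 1 => f q.1.1) :=
    hcont.comp continuous_fst.fst
  have h4 : Continuous (fun q : (E × E) × sphere (0 : E) 1 => f q.1.2) :=
    hcont.comp continuous_fst.snd
  have hnum : Continuous (fun q : (E × E) × sphere (0 : E) 1 =>
      f (collide q.2 q.1).1 * f (collide q.2 q.1).2) := h1.mul h2
  have hden : Continuous (fun q : (E × E) × sphere (0 : E) 1 => f q.1.1 * f q.1.2) := h3.mul h4
  have hlog : Continuous (fun q : (E × E) × sphere (0 : E) 1 =>
      log (f (collide q.2 q.1).1 * f (collide q.2 q.1).2 / (f q.1.1 * f q.1.2))) :=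
    (hnum.div hden fun q => (mul_pos (hpos _) (hpos _)).ne').log fun q =>
      (div_pos (mul_pos (hpos _) (hpos _)) (mul_pos (hpos _) (hpos _))).ne'
  exact hB.mul ((hnum.sub hden).mul hlog)

variable [FiniteDimensional ℝ E] [MeasurableSpace E] [BorelSpace E]

/-- The measure `dv dv_* dω` on `E × E × S^{d-1}` charges every nonempty open set (Lebesgue
measure is positive on open sets, and so is the induced measure on the unit sphere, Mathlib's
`Measure.toSphere.instIsOpenPosMeasure`). [folklore] -/
theorem isOpenPosMeasure_volume_prod_sphereMeasure :
    (((volume : Measure E).prod (volume : Measure E)).prod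
      (sphereMeasure : Measure (sphere (0 : E) 1))).IsOpenPosMeasure := by
  haveI := isFiniteMeasure_sphereMeasure (E := E)
  haveI : (sphereMeasure : Measure (sphere (0 : E) 1)).IsOpenPosMeasure := by
    unfold sphereMeasure; infer_instance
  infer_instance

/-- **hilbert6.S12, discharged** (Boltzmann's `H`-theorem, equality case; Boltzmann 1872;
Cercignani–Illner–Pulvirenti 1994 §3.2, pp. 42–43, with Thm 3.1.1; Villani 2002 Ch. 1 §2.4). In
velocity dimension `d ≥ 2`, for a continuous positive `f` with integrable weak entropy integrand
`((v - v_*)·ω)_+ (f'f_*' - f f_*) log f(v)`, the entropy production `∫ Q(f,f) log f dv` vanishes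
if and only if `f` is a Maxwellian. Proof: `∫ Q(f,f) log f = -D(f)` (weak formulation,
`integral_collisionOpWith_mul_const_add_log_eq`); `D(f) = 0` forces its continuous nonnegative
integrand to vanish identically (full support of `dv dv_* dω`), i.e. detailed balance, so `log f`
is a continuous collision invariant and `IsCollisionInvariant.exists_eq_quadratic_holds`
(CIP Thm 3.1.1) makes it `a + ⟪b, v⟫ + c ‖v‖²`; conversely `Q(M, M) = 0` for Maxwellians.
[cite: CIPDiluteGases1994, §3.2 (3.2.2)–(3.2.7), pp. 42–43] -/
theorem integral_collisionOp_mul_log_eq_zero_iff_holds :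
    integral_collisionOp_mul_log_eq_zero_iff (E := E) := by
  intro hE f hpos hcont hint
  refine ⟨fun h0 => ?_, fun hM => ?_⟩
  · -- Step 1: `∫ Q log f = -D(f)`, hence `D(f) = 0`
    have key := integral_collisionOpWith_mul_const_add_log_eq (B := hardSphereKernel (E := E))
      hardSphereKernel_collide_neg hardSphereKernel_swap_neg hpos 0
      (by simpa only [collisionIntegrand, zero_add] using hint)
    simp only [zero_add, collisionOpWith_hardSphereKernel] at key
    rw [h0] at key
    -- Step 2: the entropy-production integrand is nonnegative, integrable, of integral zero
    set μ : Measure ((E × E) × sphere (0 : E) 1) :=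
      ((volume : Measure E).prod volume).prod sphereMeasure with hμ
    set P : (E × E) × sphere (0 : E) 1 → ℝ := fun q => hardSphereKernel q.1 q.2 *
      ((f (collide q.2 q.1).1 * f (collide q.2 q.1).2 - f q.1.1 * f q.1.2) *
        log (f (collide q.2 q.1).1 * f (collide q.2 q.1).2 / (f q.1.1 * f q.1.2))) with hP
    have hPi : Integrable P μ :=
      integrable_entropyProduction_integrand hardSphereKernel_collide_neg hardSphereKernel_swap_neg
        hpos (by simpa only [collisionIntegrand] using hint)
    have hP0 : 0 ≤ P := by
      intro q
      refine mul_nonneg (le_max_right _ _) ?_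
      have ha : 0 < f (collide q.2 q.1).1 * f (collide q.2 q.1).2 := mul_pos (hpos _) (hpos _)
      have hb : 0 < f q.1.1 * f q.1.2 := mul_pos (hpos _) (hpos _)
      rcases le_total (f q.1.1 * f q.1.2) (f (collide q.2 q.1).1 * f (collide q.2 q.1).2)
        with hab | hab
      · exact mul_nonneg (sub_nonneg.2 hab) (log_nonneg ((one_le_div hb).2 hab))
      · exact mul_nonneg_of_nonpos_of_nonpos (sub_nonpos.2 hab)
          (log_nonpos (div_pos ha hb).le ((div_le_one hb).2 hab))
    have hPint : ∫ q, P q ∂μ = 0 := by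
      have hD : (4 : ℝ)⁻¹ * ∫ q, P q ∂μ = 0 := by
        have e : entropyProduction (hardSphereKernel (E := E)) f = 4⁻¹ * ∫ q, P q ∂μ := rfl
        rw [← e]; linarith
      simpa using hD
    have hPae : P =ᵐ[μ] 0 := (integral_eq_zero_iff_of_nonneg hP0 hPi).1 hPint
    -- Step 3: continuity and full support: the integrand vanishes identically
    haveI : μ.IsOpenPosMeasure := isOpenPosMeasure_volume_prod_sphereMeasure
    have hPzero : P = 0 :=
      Measure.eq_of_ae_eq hPae (continuous_hardSphereEntropyIntegrand hpos hcont) continuous_const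
    -- Step 4: `log f` is a continuous collision invariant, hence quadratic
    have hinv : IsCollisionInvariant (fun v => log (f v)) :=
      isCollisionInvariant_log_of_hardSphereEntropyIntegrand_eq_zero hpos fun p ω => by
        have := congrFun hPzero (p, ω)
        simpa only [hP, Pi.zero_apply] using this
    obtain ⟨a, c, b, habc⟩ := IsCollisionInvariant.exists_eq_quadratic_holds hE hinv
      (hcont.log fun v => (hpos v).ne')
    exact ⟨a, c, b, fun v => by rw [← habc v, exp_log (hpos v)]⟩
  · -- a Maxwellian annihilates the collision operator pointwise
    simp [collisionOp_eq_zero_of_isMaxwellian hM]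

end Literature.MathematicalPhysics.KineticTheory
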